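import Summits.ABC.ABC.Theses.DefiniteXi
import Summits.ABC.ABC.Theorems.DefiniteXiDefiniteRTControlPrimeOfTakahashi
import Summits.ABC.ABC.Theorems.DefiniteXiMinimalBoundGivesTarget
import Summits.ABC.ABC.Theorems.DefiniteXiDegreeBoundToABCOfPetersson
import Summits.ABC.ABC.Theorems.RibetTakahashiSplitWeightedSzpiroBoundForgivenDegreeBoundOfDefiniteXi
import HarnessLib

/-!
# Owner path (α) for crux `DefiniteXi.DefiniteRTControlPrime` (stmt-ABC-11338): tenure RE-GLUE, typed and checked
# (stub-ideation k2 g13 for `stub_pastenLemma68`; sharpening of k1-g20 `closes_of_takahashiItem` after the k2-g12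
# landing p839521: the Mazur–Kenku binder `hMK` is GONE).

After promoting Takahashi 2001 Thm 2.3 (coprime form) to a route item `TakahashiDegreeFormulaCoprime` (body
VERBATIM the Literature fact, `Iff.rfl`; kind `aside`/support r9, "KNOWN in print, XL formal debt" — the same
move this route made for `MazurKenkuBound` = stmt-ABC-15125), the deciding theorem re-glues with `hT` in place of
`hRT : DefiniteRTControlPrime`, through the LANDED `definiteRTControlPrime_of_takahashi` (no Lemma 6.8, no 163,
no `MazurKenkuBound`).  `DefiniteRTControlPrime` then leaves the cone of `closes` (mark it `aside` on the same
edit, BC6) and its three skeleton stubs stop being armed.  Open load-bearing binders afterwards: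
{EisensteinQuarantine, SteinbergCore, TakahashiDegreeFormulaCoprime, FreyModularity, PeterssonLowerBound} = 5.
-/

set_option linter.dupNamespace false

namespace Summit.ABC.ABC.Cruxes.DefiniteRTControlPrime.GlueTakahashiItem

open Summit.ABC.ABC.Theses.DefiniteXi
open Literature.NumberTheory.EllipticCurves Literature.NumberTheory.EllipticCurves.ModularForms
open Literature.NumberTheory.Automorphic

/-- Proposed route item (k1-g20 verbatim), body = the Literature fact `takahashi2001_thm_2_3_of_coprime`.
[cite: Takahashi2001, Thm. 2.3 (p. 79)] -/
def TakahashiDegreeFormulaCoprime : Prop :=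
  ∀ (W : WeierstrassCurve ℚ) [W.IsElliptic] (M r : ℕ) [NeZero (M * r)],
    r.Prime → M.Coprime r → W.conductorNorm ℤ = M * r →
    ∀ P : ModularParametrizationData W (M * r),
      (∀ (W' : WeierstrassCurve ℚ) [W'.IsElliptic], W'.conductorNorm ℤ = M * r →
          ∀ P' : ModularParametrizationData W' (M * r),
          P'.f = P.f → P.modularDegree ≤ P'.modularDegree) →
      ∀ S : Brandt.XiSetup M r,
        ∃ i j : ℕ, 0 < i ∧ i * j = (W.minimalDiscriminantNorm ℤ).factorization r ∧
          i ∣ S.xi (fun n => W.LFunction n) ∧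
          P.modularDegree * i = S.xi (fun n => W.LFunction n) * j

theorem takahashiDegreeFormulaCoprime_iff :
    TakahashiDegreeFormulaCoprime ↔ takahashi2001_thm_2_3_of_coprime :=
  Iff.rfl

/-- The crux from the ONE promoted item (landed k2-g12 chain, part 7/7). -/
theorem definiteRTControlPrime_of_item (hT : TakahashiDegreeFormulaCoprime) : DefiniteRTControlPrime :=
  Summit.ABC.ABC.Theorems.DefiniteRTControlPrime.definiteRTControlPrime_of_takahashi hT

/-- (α) The re-glued deciding theorem: binders are route items only; `hRT` replaced by `hT`; NO `hMK`. -/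
theorem closes_of_takahashiItem (hEis : EisensteinQuarantine) (hCore : SteinbergCore)
    (hT : TakahashiDegreeFormulaCoprime)
    (hGlue : DefiniteGlue) (hMod : FreyModularity) (hMin : MinimalBoundGivesTarget)
    (hP : PeterssonLowerBound) (hDeg : DegreeBoundToABCOfPetersson) : _root_.ABC :=
  closes hEis hCore (definiteRTControlPrime_of_item hT) hGlue hMod hMin hP hDeg

/-- (α′) Same with the three PROVED supports discharged by name: the OPEN load-bearing binders of the re-glued
route are exactly these five. -/
theorem closes_of_takahashiItem' (hEis : EisensteinQuarantine) (hCore : SteinbergCore)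
    (hT : TakahashiDegreeFormulaCoprime) (hMod : FreyModularity) (hP : PeterssonLowerBound) : _root_.ABC :=
  closes_of_takahashiItem hEis hCore hT
    Summit.ABC.ABC.Theorems.TwoAdicEisensteinAnchor.definiteGlue_holds hMod
    Summit.ABC.ABC.Theorems.minimalBoundGivesTarget_proof hP
    Summit.ABC.ABC.Theorems.degreeBoundToABCOfPetersson_proof

end Summit.ABC.ABC.Cruxes.DefiniteRTControlPrime.GlueTakahashiItem
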